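import Summits.CriticalPhenomena.PercolationContinuityZ3.Theorems.PercNearOneGluingNoHeavyLowerTailSahiLatinZeroBottomPeel

/-!
# `NoHeavyLowerTail` (crux stmt-CriticalPhenomena-4575), Sahi programme (prim-master-conj gen 49): THE FOUR-SET GRID INVARIANT `Grid4` of the
# zero-bottom functional and its PAIRING LEMMAS — `Grid4` reproduces itself when a free or a primed literal coordinate is added

Support file (`--supports stmt-CriticalPhenomena-4575`; one definition (`Grid4`, a `Prop`) + proofs, no `sorry`).  Memo
`run/shared/lean/prim/prim-l12/FROM-prim-master-conj-g49-PEELING-THEOREM.md` §3.  Nothing here asserts the crux, Kahn's conjecture or (C¼).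

THE MATHEMATICS.  For data `(P, b, Q, c)` on `[3]^κ` the GRID INVARIANT `Grid4 P b Q c` says: for all up-sets `H_SS, H_SO, H_OS, H_OO` with
`H_OO ⊆ H_SO ⊆ H_SS`, `H_OO ⊆ H_OS ⊆ H_SS`, `P ∪ Q ⊆ H_SS`, `P ⊆ H_SO`, `Q ⊆ H_OS`,
  `0 ≤ cSS(H_SS) + cSO(H_SO) + cOS(H_OS) + cOO(H_OO)`   (parts of `…SahiLatinZeroBottomPsi`, evaluated with the same `P, b, Q, c`).
With all four sets equal it gives `0 ≤ Psi F P b Q c` for every up-set `F ⊇ P ∪ Q` (`psi_nonneg_of_grid4`), i.e. (by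
`three_kappa_top_le_iff_psi_nonneg`) top-slice dominance with the constant `3/2` for the lower-step clothing whenever `κ(F,P,Q) = 0`.
**PAIRING LEMMAS** (every `κ`): if `Grid4 P b Q c` holds on `[3]^κ`, then `Grid4` holds on `[3]^{Option κ}` for the instance lifted by
* a free coordinate (`grid4_free`), * an `I′`-literal of threshold `2` or `1` (`grid4_primeP_two`, `grid4_primeP_one`),
* a `J′`-literal of threshold `2` or `1` (`grid4_primeQ_two`, `grid4_primeQ_one`).
Proof: write each `H` as `ofSections` of its sections (`ofSections_sec`), apply the peeling identities of `…ZeroBottomPeel`, and regroup the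
level terms into instances of the hypothesis — an S-unit at level `l` is paired with an O-unit at a level `l′ ≤ l` (`2↔0, 2↔1` for threshold 2;
`1↔0, 1↔0, 2↔1, 2↔2` for threshold 1), the nestings `sec H_OO l′ ⊆ sec H_SO l` etc. holding because sections of up-sets increase with the level.
This is the inductive step of the memo's PEELING THEOREM ((C¼) on the conjunctive zero-bottom family); the base (core instances) is the
companion file to come.  Axioms standard. [this work]
-/

namespace Summit.CriticalPhenomena.PercolationContinuityZ3.Theorems.SahiLatin

open Finset

variable {κ : Type*} [Fintype κ] [DecidableEq κ]

/-! ## §1  The invariant -/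

/-- **The four-set grid invariant** of the zero-bottom data `(P, b, Q, c)`. [this work] -/
def Grid4 (P b Q c : Finset (Pt κ)) : Prop :=
  ∀ HSS HSO HOS HOO : Finset (Pt κ),
    IsUpperSet (HSS : Set (Pt κ)) → IsUpperSet (HSO : Set (Pt κ)) → IsUpperSet (HOS : Set (Pt κ)) → IsUpperSet (HOO : Set (Pt κ)) →
    HOO ⊆ HSO → HOO ⊆ HOS → HSO ⊆ HSS → HOS ⊆ HSS → P ∪ Q ⊆ HSS → P ⊆ HSO → Q ⊆ HOS →
    0 ≤ cSS HSS P b Q c + cSO HSO P b Q c + cOS HOS P b Q c + cOO HOO P b Q c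

/-- The grid invariant gives `0 ≤ Ψ(F)` for every up-set `F ⊇ P ∪ Q` (all four sets equal to `F`). [this work] -/
theorem psi_nonneg_of_grid4 {P b Q c : Finset (Pt κ)} (h : Grid4 P b Q c) {F : Finset (Pt κ)} (hF : IsUpperSet (F : Set (Pt κ)))
    (hPQ : P ∪ Q ⊆ F) : 0 ≤ Psi F P b Q c := by
  have hP : P ⊆ F := (subset_union_left).trans hPQ
  have hQ : Q ⊆ F := (subset_union_right).trans hPQ
  exact h F F F F hF hF hF hF (subset_refl _) (subset_refl _) (subset_refl _) (subset_refl _) hPQ hP hQ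

/-! ## §2  Sections: three small lemmas -/

/-- A set over `[3]^{Option κ}` is glued from its three sections. [this work] -/
theorem ofSections_sec (H : Finset (Pt (Option κ))) : ofSections (sec H 0) (sec H 1) (sec H 2) = H := by
  ext x
  rw [mem_ofSections_iff, sec_ofSections, ← glue_eta x]
  simp only [glue_none]
  have e : (fun k => glue (x none) (fun k => x (some k)) (some k)) = fun k => x (some k) := funext fun k => rfl
  rw [e]
  generalize x none = l
  fin_cases l <;> simp

/-- Sections are monotone in the set. [this work] -/
theorem sec_subset_sec {H H' : Finset (Pt (Option κ))} (h : H ⊆ H') (l : Fin 3) : sec H l ⊆ sec H' l := by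
  intro x' hx; rw [mem_sec] at hx ⊢; exact h hx

/-- `ofSections s₀ s₁ s₂ ⊆ H` iff the three sections of `H` contain `s₀, s₁, s₂`. [this work] -/
theorem ofSections_subset_iff {s₀ s₁ s₂ : Finset (Pt κ)} {H : Finset (Pt (Option κ))} :
    ofSections s₀ s₁ s₂ ⊆ H ↔ s₀ ⊆ sec H 0 ∧ s₁ ⊆ sec H 1 ∧ s₂ ⊆ sec H 2 := by
  constructor
  · intro h
    refine ⟨?_, ?_, ?_⟩
    · have := sec_subset_sec h 0; rwa [sec_ofSections_zero] at this
    · have := sec_subset_sec h 1; rwa [sec_ofSections_one] at this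
    · have := sec_subset_sec h 2; rwa [sec_ofSections_two] at this
  · rintro ⟨h0, h1, h2⟩ x hx
    rw [← glue_eta x] at hx ⊢
    rw [glue_mem_ofSections] at hx
    rw [← mem_sec]
    rcases hx with ⟨e, hm⟩ | ⟨e, hm⟩ | ⟨e, hm⟩ <;> rw [e]
    · exact h0 hm
    · exact h1 hm
    · exact h2 hm

/-- Unions of glued sets. [this work] -/
theorem ofSections_union (s₀ s₁ s₂ t₀ t₁ t₂ : Finset (Pt κ)) :
    ofSections s₀ s₁ s₂ ∪ ofSections t₀ t₁ t₂ = ofSections (s₀ ∪ t₀) (s₁ ∪ t₁) (s₂ ∪ t₂) := by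
  ext x
  rw [mem_union, ← glue_eta x, glue_mem_ofSections, glue_mem_ofSections, glue_mem_ofSections]
  simp only [mem_union]
  generalize x none = l
  fin_cases l <;> simp

/-! ## §3  The pairing lemmas -/

section pairing
variable {P b Q c : Finset (Pt κ)} (hG : Grid4 P b Q c)
include hG

/-- Common bookkeeping: the hypothesis `Grid4` applied to sections `(sec HSS l, sec HSO l, sec HOS l', sec HOO l')` with `l' ≤ l`. [this work] -/
theorem grid4_sections {HSS HSO HOS HOO : Finset (Pt (Option κ))}
    (uSS : IsUpperSet (HSS : Set (Pt (Option κ)))) (uSO : IsUpperSet (HSO : Set (Pt (Option κ))))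
    (uOS : IsUpperSet (HOS : Set (Pt (Option κ)))) (uOO : IsUpperSet (HOO : Set (Pt (Option κ))))
    (n1 : HOO ⊆ HSO) (n2 : HOO ⊆ HOS) (n3 : HSO ⊆ HSS) (n4 : HOS ⊆ HSS) {l l' : Fin 3} (hll : l' ≤ l)
    (fSS : P ∪ Q ⊆ sec HSS l) (fSO : P ⊆ sec HSO l) (fOS : Q ⊆ sec HOS l') :
    0 ≤ cSS (sec HSS l) P b Q c + cSO (sec HSO l) P b Q c + cOS (sec HOS l') P b Q c + cOO (sec HOO l') P b Q c :=
  hG _ _ _ _ (isUpperSet_sec uSS l) (isUpperSet_sec uSO l) (isUpperSet_sec uOS l') (isUpperSet_sec uOO l')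
    ((sec_subset_sec n1 l').trans (sec_mono uSO hll)) (sec_subset_sec n2 l') (sec_subset_sec n3 l)
    ((sec_mono uOS hll).trans (sec_subset_sec n4 l)) fSS fSO fOS

/-- **Pairing lemma, free coordinate**: `Grid4` lifts through a coordinate on which all four sets are cylinders. [this work] -/
theorem grid4_free : Grid4 (ofSections P P P) (ofSections b b b) (ofSections Q Q Q) (ofSections c c c) := by
  intro HSS HSO HOS HOO uSS uSO uOS uOO n1 n2 n3 n4 f1 f2 f3
  rw [← ofSections_sec HSS, ← ofSections_sec HSO, ← ofSections_sec HOS, ← ofSections_sec HOO,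
    cSS_free, cSO_free, cOS_free, cOO_free]
  rw [ofSections_union, ofSections_subset_iff] at f1
  rw [ofSections_subset_iff] at f2 f3
  have h0 := grid4_sections hG uSS uSO uOS uOO n1 n2 n3 n4 (le_refl (0 : Fin 3)) f1.1 f2.1 f3.1
  have h1 := grid4_sections hG uSS uSO uOS uOO n1 n2 n3 n4 (le_refl (1 : Fin 3)) f1.2.1 f2.2.1 f3.2.1
  have h2 := grid4_sections hG uSS uSO uOS uOO n1 n2 n3 n4 (le_refl (2 : Fin 3)) f1.2.2 f2.2.2 f3.2.2
  linarith

/-- **Pairing lemma, `I′`-literal of threshold `2`** (pairs `2↔0`, `2↔1`). [this work] -/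
theorem grid4_primeP_two : Grid4 (ofSections ∅ ∅ P) (ofSections ∅ ∅ b) (ofSections Q Q Q) (ofSections c c c) := by
  intro HSS HSO HOS HOO uSS uSO uOS uOO n1 n2 n3 n4 f1 f2 f3
  rw [← ofSections_sec HSS, ← ofSections_sec HSO, ← ofSections_sec HOS, ← ofSections_sec HOO,
    cSS_primeP_two, cSO_primeP_two, cOS_primeP_two, cOO_primeP_two]
  rw [ofSections_union, ofSections_subset_iff] at f1
  rw [ofSections_subset_iff] at f2 f3
  simp only [empty_union] at f1
  have h20 := grid4_sections hG uSS uSO uOS uOO n1 n2 n3 n4 (show (0 : Fin 3) ≤ 2 by decide) f1.2.2 f2.2.2 f3.1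
  have h21 := grid4_sections hG uSS uSO uOS uOO n1 n2 n3 n4 (show (1 : Fin 3) ≤ 2 by decide) f1.2.2 f2.2.2 f3.2.1
  linarith

/-- **Pairing lemma, `I′`-literal of threshold `1`** (pairs `1↔0`, `1↔0`, `2↔1`, `2↔2`). [this work] -/
theorem grid4_primeP_one : Grid4 (ofSections ∅ P P) (ofSections ∅ b b) (ofSections Q Q Q) (ofSections c c c) := by
  intro HSS HSO HOS HOO uSS uSO uOS uOO n1 n2 n3 n4 f1 f2 f3
  rw [← ofSections_sec HSS, ← ofSections_sec HSO, ← ofSections_sec HOS, ← ofSections_sec HOO,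
    cSS_primeP_one, cSO_primeP_one, cOS_primeP_one, cOO_primeP_one]
  rw [ofSections_union, ofSections_subset_iff] at f1
  rw [ofSections_subset_iff] at f2 f3
  simp only [empty_union] at f1
  have h10 := grid4_sections hG uSS uSO uOS uOO n1 n2 n3 n4 (show (0 : Fin 3) ≤ 1 by decide) f1.2.1 f2.2.1 f3.1
  have h21 := grid4_sections hG uSS uSO uOS uOO n1 n2 n3 n4 (show (1 : Fin 3) ≤ 2 by decide) f1.2.2 f2.2.2 f3.2.1
  have h22 := grid4_sections hG uSS uSO uOS uOO n1 n2 n3 n4 (le_refl (2 : Fin 3)) f1.2.2 f2.2.2 f3.2.2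
  linarith

end pairing

/-! The `J′` cases: by the same bookkeeping with the roles of the second index. -/

section pairingQ
variable {P b Q c : Finset (Pt κ)} (hG : Grid4 P b Q c)
include hG

/-- Bookkeeping for the `J′` cases: `Grid4` applied to `(sec HSS l, sec HSO l', sec HOS l, sec HOO l')` with `l' ≤ l`. [this work] -/
theorem grid4_sections' {HSS HSO HOS HOO : Finset (Pt (Option κ))}
    (uSS : IsUpperSet (HSS : Set (Pt (Option κ)))) (uSO : IsUpperSet (HSO : Set (Pt (Option κ))))
    (uOS : IsUpperSet (HOS : Set (Pt (Option κ)))) (uOO : IsUpperSet (HOO : Set (Pt (Option κ))))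
    (n1 : HOO ⊆ HSO) (n2 : HOO ⊆ HOS) (n3 : HSO ⊆ HSS) (n4 : HOS ⊆ HSS) {l l' : Fin 3} (hll : l' ≤ l)
    (fSS : P ∪ Q ⊆ sec HSS l) (fSO : P ⊆ sec HSO l') (fOS : Q ⊆ sec HOS l) :
    0 ≤ cSS (sec HSS l) P b Q c + cSO (sec HSO l') P b Q c + cOS (sec HOS l) P b Q c + cOO (sec HOO l') P b Q c :=
  hG _ _ _ _ (isUpperSet_sec uSS l) (isUpperSet_sec uSO l') (isUpperSet_sec uOS l) (isUpperSet_sec uOO l')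
    (sec_subset_sec n1 l') ((sec_subset_sec n2 l').trans (sec_mono uOS hll)) ((sec_mono uSO hll).trans (sec_subset_sec n3 l))
    (sec_subset_sec n4 l) fSS fSO fOS

/-- **Pairing lemma, `J′`-literal of threshold `2`**. [this work] -/
theorem grid4_primeQ_two : Grid4 (ofSections P P P) (ofSections b b b) (ofSections ∅ ∅ Q) (ofSections ∅ ∅ c) := by
  intro HSS HSO HOS HOO uSS uSO uOS uOO n1 n2 n3 n4 f1 f2 f3
  rw [← ofSections_sec HSS, ← ofSections_sec HSO, ← ofSections_sec HOS, ← ofSections_sec HOO,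
    cSS_primeQ_two, cSO_primeQ_two, cOS_primeQ_two, cOO_primeQ_two]
  rw [ofSections_union, ofSections_subset_iff] at f1
  rw [ofSections_subset_iff] at f2 f3
  simp only [union_empty] at f1
  have h20 := grid4_sections' hG uSS uSO uOS uOO n1 n2 n3 n4 (show (0 : Fin 3) ≤ 2 by decide) f1.2.2 f2.1 f3.2.2
  have h21 := grid4_sections' hG uSS uSO uOS uOO n1 n2 n3 n4 (show (1 : Fin 3) ≤ 2 by decide) f1.2.2 f2.2.1 f3.2.2
  linarith

/-- **Pairing lemma, `J′`-literal of threshold `1`**. [this work] -/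
theorem grid4_primeQ_one : Grid4 (ofSections P P P) (ofSections b b b) (ofSections ∅ Q Q) (ofSections ∅ c c) := by
  intro HSS HSO HOS HOO uSS uSO uOS uOO n1 n2 n3 n4 f1 f2 f3
  rw [← ofSections_sec HSS, ← ofSections_sec HSO, ← ofSections_sec HOS, ← ofSections_sec HOO,
    cSS_primeQ_one, cSO_primeQ_one, cOS_primeQ_one, cOO_primeQ_one]
  rw [ofSections_union, ofSections_subset_iff] at f1
  rw [ofSections_subset_iff] at f2 f3
  simp only [union_empty] at f1
  have h10 := grid4_sections' hG uSS uSO uOS uOO n1 n2 n3 n4 (show (0 : Fin 3) ≤ 1 by decide) f1.2.1 f2.1 f3.2.1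
  have h21 := grid4_sections' hG uSS uSO uOS uOO n1 n2 n3 n4 (show (1 : Fin 3) ≤ 2 by decide) f1.2.2 f2.2.1 f3.2.2
  have h22 := grid4_sections' hG uSS uSO uOS uOO n1 n2 n3 n4 (le_refl (2 : Fin 3)) f1.2.2 f2.2.2 f3.2.2
  linarith

end pairingQ

end Summit.CriticalPhenomena.PercolationContinuityZ3.Theorems.SahiLatin
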